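import Summits.QuantumFields.YangMills.Theorems.ParabolicTrajectoryLatticeGapOnTrajectorySparseDefectDefs
import HarnessLib

/-!
# Crux `LatticeGapOnTrajectory` (stmt-QuantumFields-10523), line `sparse-defect-orbit-window`:
# stub (U) `stub_sparseUnderOfLargeField` — joint sparseness of bad cells from large-field sparseness

Registered stub (U) of the line skeleton, `--supports stmt-QuantumFields-10523` (G-blind finite
probability; nothing about mass gaps is asserted, everything here is proved).

If at coupling `β` and side `2S+1` every prescribed plaquette set `X` is jointly `ε₀`-large with
probability `≤ e^{−cβ|X|}` under Wilson's torus measure (the body of `LargeFieldSparse r` at `(β, S)`,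
with `cβ ≥ 0`), and the bad event of each coarse cell `x` is covered by `J` prescribed large-field
events `{every p ∈ P x j is ε₀-large}` with `|P x j| ≥ m`, the families of distinct cells being
pairwise disjoint, then for every finite set of cells `X`,
`μ_β(every cell of X is bad) ≤ (J e^{−cβm})^{|X|}`, i.e. `SparseUnder μ_β good (J e^{−cβm})`.

Proof (union bound). For a bad configuration pick, for each `x ∈ X`, an index `φ x : Fin J` whose
event holds; the bad event is thus covered by the `J^{|X|}` events
`{every p ∈ ⋃_{x ∈ X} P x (φ x) is large}` indexed by the choice functions `φ : X → Fin J`. By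
disjointness `|⋃_{x ∈ X} P x (φ x)| = Σ_{x ∈ X} |P x (φ x)| ≥ m|X|`, so each event has probability
`≤ e^{−cβ m |X|} = (e^{−cβm})^{|X|}` (monotonicity of `exp`, `cβ ≥ 0`), and summing over the
`J^{|X|}` choice functions gives `J^{|X|} (e^{−cβm})^{|X|} = (J e^{−cβm})^{|X|}`.
-/

set_option autoImplicit false

noncomputable section

namespace Summit.QuantumFields.YangMills.Cruxes.LatticeGapOnTrajectory.SparseDefectOrbitWindow

open scoped BigOperators ENNReal
open MeasureTheory
open Literature.MathematicalPhysics.QuantumFieldTheory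
open Summit.QuantumFields.YangMills.Cruxes.LatticeGapOnTrajectory.OrbitKantorovichFiniteSize

namespace StubSparseUnderOfLargeField

/-- ENNReal bookkeeping for the union bound: `J ^ k` copies of `ofReal (a ^ k)` sum to
`ofReal ((J a) ^ k)`. -/
theorem pow_nsmul_ofReal_pow (J k : ℕ) (a : ℝ) :
    (J ^ k) • ENNReal.ofReal (a ^ k) = ENNReal.ofReal (((J : ℝ) * a) ^ k) := by
  rw [nsmul_eq_mul, mul_pow, ENNReal.ofReal_mul (by positivity), ← ENNReal.ofReal_natCast,
    Nat.cast_pow]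

/-- The exponential comparison: if `m k ≤ n` and `0 ≤ t` then `exp (−t n) ≤ (exp (−t m)) ^ k`. -/
theorem exp_neg_mul_le_pow {t : ℝ} (ht : 0 ≤ t) {m k n : ℕ} (h : m * k ≤ n) :
    Real.exp (-(t * n)) ≤ Real.exp (-(t * m)) ^ k := by
  have h1 : (m : ℝ) * k ≤ n := by exact_mod_cast h
  have h2 : t * ((m : ℝ) * k) ≤ t * n := mul_le_mul_of_nonneg_left h1 ht
  calc Real.exp (-(t * n)) ≤ Real.exp (-(t * ((m : ℝ) * k))) := Real.exp_le_exp.mpr (neg_le_neg h2)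
    _ = Real.exp (-(t * m)) ^ k := by
      rw [← Real.exp_nat_mul]
      congr 1
      ring

/-- Cardinality of a disjoint union of sets of size `≥ m` indexed by (the subtype of) a finset `X`:
at least `m |X|`. -/
theorem mul_card_le_card_biUnion {ι κ : Type} [DecidableEq κ] (X : Finset ι) (m : ℕ)
    (Q : ↥X → Finset κ) (hm : ∀ x, m ≤ (Q x).card)
    (hdisj : ∀ x x' : ↥X, x ≠ x' → Disjoint (Q x) (Q x')) :
    m * X.card ≤ (X.attach.biUnion Q).card := by
  rw [Finset.card_biUnion fun x _ x' _ hxx' => hdisj x x' hxx']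
  calc m * X.card = ∑ _x ∈ X.attach, m := by
        rw [Finset.sum_const, Finset.card_attach, smul_eq_mul, mul_comm]
    _ ≤ ∑ x ∈ X.attach, (Q x).card := Finset.sum_le_sum fun x _ => hm x

end StubSparseUnderOfLargeField

open StubSparseUnderOfLargeField in
/-- **Stub (U) `stub_sparseUnderOfLargeField`** (G-blind TOOL): joint sparseness of bad cells under
Wilson's torus measure from large-field sparseness by the UNION BOUND. If at coupling `β` and side
`2S+1` every prescribed plaquette set is jointly `ε₀`-large with probability `≤ e^{−cβ|X|}` (the body of
`LargeFieldSparse r` at `(β, S)`), and the bad event of each cell `x` is covered by `J` prescribed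
large-field events `{every p ∈ P x j is ε₀-large}` with `|P x j| ≥ m`, the families of distinct cells
being pairwise disjoint, then `μ_β(every cell of X is bad) ≤ (J e^{−cβm})^{|X|}` for every finite set of
cells `X` — i.e. `SparseUnder μ_β good (J e^{−cβm})`. (Sum over the `J^{|X|}` choice functions on `X`;
for each, the union of the chosen sets has `≥ m|X|` plaquettes.) -/
theorem stub_sparseUnderOfLargeField :
    ∀ (G : Type) [Group G] [TopologicalSpace G] [IsTopologicalGroup G] [CompactSpace G]
      [MeasurableSpace G] [BorelSpace G] (r : LatticeRep G) (ε₀ c β : ℝ) (S : ℕ), 0 ≤ c * β →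
      (∀ X : Finset (Plaquette 4 (2 * S + 1)),
        wilsonMeasure (d := 4) (L := 2 * S + 1) r.ρ β
            {U | ∀ p ∈ X, ε₀ ≤ (r.N : ℝ) - (r.ρ (plaquetteHolonomy U p.1 p.2.1.1 p.2.1.2)).trace.re} ≤
          ENNReal.ofReal (Real.exp (-(c * β * X.card)))) →
      ∀ {μ : Fin 4 → ℕ} (good : CoarseIdx μ → Set (GaugeConfig 4 (2 * S + 1) G)) (J m : ℕ)
        (P : CoarseIdx μ → Fin J → Finset (Plaquette 4 (2 * S + 1))),
        (∀ (x : CoarseIdx μ) (U : GaugeConfig 4 (2 * S + 1) G), U ∉ good x → ∃ j : Fin J, ∀ p ∈ P x j,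
            ε₀ ≤ (r.N : ℝ) - (r.ρ (plaquetteHolonomy U p.1 p.2.1.1 p.2.1.2)).trace.re) →
        (∀ x j, m ≤ (P x j).card) →
        (∀ (x x' : CoarseIdx μ) (j j' : Fin J), x ≠ x' → Disjoint (P x j) (P x' j')) →
          SparseUnder (wilsonMeasure (d := 4) (L := 2 * S + 1) r.ρ β) good
            ((J : ℝ) * Real.exp (-(c * β * m))) := by
  intro G _ _ _ _ _ _ r ε₀ c β S hcβ hLF μ good J m P hcover hm hdisj X
  classical
  -- the large-field predicate of a plaquette and the chosen plaquette set of a choice function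
  set large : GaugeConfig 4 (2 * S + 1) G → Plaquette 4 (2 * S + 1) → Prop := fun U p =>
    ε₀ ≤ (r.N : ℝ) - (r.ρ (plaquetteHolonomy U p.1 p.2.1.1 p.2.1.2)).trace.re
  set Y : (↥X → Fin J) → Finset (Plaquette 4 (2 * S + 1)) := fun φ =>
    X.attach.biUnion fun x => P x.1 (φ x)
  -- (1) cover of the bad event by the `J ^ |X|` prescribed large-field events
  have hcov : {σ : GaugeConfig 4 (2 * S + 1) G | ∀ x ∈ X, σ ∉ good x} ⊆
      ⋃ φ : ↥X → Fin J, {U | ∀ p ∈ Y φ, large U p} := by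
    intro σ hσ
    choose j hj using fun x : ↥X => hcover x.1 σ (hσ x.1 x.2)
    refine Set.mem_iUnion.2 ⟨j, fun p hp => ?_⟩
    obtain ⟨x, -, hx⟩ := Finset.mem_biUnion.1 hp
    exact hj x p hx
  -- (2) each chosen union has at least `m |X|` plaquettes (disjointness across distinct cells)
  have hcard : ∀ φ : ↥X → Fin J, m * X.card ≤ (Y φ).card := fun φ =>
    mul_card_le_card_biUnion X m (fun x => P x.1 (φ x)) (fun x => hm x.1 (φ x))
      fun x x' hxx' => hdisj x.1 x'.1 (φ x) (φ x') fun h => hxx' (Subtype.ext h)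
  -- (3) each piece is bounded by the large-field hypothesis and monotonicity of `exp`
  have hpiece : ∀ φ : ↥X → Fin J,
      wilsonMeasure (d := 4) (L := 2 * S + 1) r.ρ β {U | ∀ p ∈ Y φ, large U p} ≤
        ENNReal.ofReal (Real.exp (-(c * β * m)) ^ X.card) := fun φ =>
    (hLF (Y φ)).trans (ENNReal.ofReal_le_ofReal (exp_neg_mul_le_pow hcβ (hcard φ)))
  -- (4) union bound and bookkeeping
  calc wilsonMeasure (d := 4) (L := 2 * S + 1) r.ρ β {σ | ∀ x ∈ X, σ ∉ good x}
      ≤ wilsonMeasure (d := 4) (L := 2 * S + 1) r.ρ β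
          (⋃ φ : ↥X → Fin J, {U | ∀ p ∈ Y φ, large U p}) := measure_mono hcov
    _ ≤ ∑ φ : ↥X → Fin J,
          wilsonMeasure (d := 4) (L := 2 * S + 1) r.ρ β {U | ∀ p ∈ Y φ, large U p} :=
        measure_iUnion_fintype_le _ _
    _ ≤ ∑ _φ : ↥X → Fin J, ENNReal.ofReal (Real.exp (-(c * β * m)) ^ X.card) :=
        Finset.sum_le_sum fun φ _ => hpiece φ
    _ = (J ^ X.card) • ENNReal.ofReal (Real.exp (-(c * β * m)) ^ X.card) := by
        rw [Finset.sum_const, Finset.card_univ, Fintype.card_fun, Fintype.card_fin, Fintype.card_coe]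
    _ = ENNReal.ofReal (((J : ℝ) * Real.exp (-(c * β * m))) ^ X.card) :=
        pow_nsmul_ofReal_pow J X.card _

end Summit.QuantumFields.YangMills.Cruxes.LatticeGapOnTrajectory.SparseDefectOrbitWindow
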